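import Summits.HodgeConjecture.HodgeConjecture.Theorems.R90S10ArchTransferSignsOfArchKit   -- ★ S10 kit: `archDeltaPP`, `IsArchEndoCharId`, `IsArchStablyNull`, `ArchCompatibleFamiliesH`, (W)(C) tokens
import Summits.HodgeConjecture.HodgeConjecture.Theorems.R90S2TensorRepLetterDefs          -- ★ p864621 ℓ3: `HasLocalComponents` (+ ★ `archTensor`, `CuspH₀`, `AreUnitarilyEquivalent`)
import Summits.HodgeConjecture.HodgeConjecture.Theorems.R90S2ArchBlockPairLetterDefs       -- ★ ℓ1 (R90-C11-typ2): `BlockPairData`, `memberSign`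
import HarnessLib

/-!
# R90-TF ∕ S2 «Ch. 12 archimedean block» — `R90S2ArchPacketEndoscopyLetterDefs`: LETTERS-DEFS part ℓT2-E — the global-archimedean ENDOSCOPY LETTER
# `ArchPacketEndoscopyLetter L μ S` for tensor families of block pairs, in T2's frame (the last letter of T2's payment road)

ERRATUM (ED. 2, docstring only; RULING R-S2-E1 of the S2 desk K2E1b-plan (g8), 2026-09-05T03:01:08Z, adopting audit E-1 of R90-C11-audit1 (g2)): this TWO-MEMBER
(`Bool`-indexed) form is SUPERSEDED by ★ `ArchBlockPacketEndoscopyLetter` (`R90S2ArchBlockPacketEndoscopyLetterDefs`, full local packets `Fin 3`) and is NOT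
EXPECTED TO HOLD as a socket: print's local `L`-packets have THREE members (p. 218 L11–14, `Tr ρ_v(f_v^H) = Σ_{1≤j≤3} ⟨ρ_v, π_{jv}⟩ Tr π_{jv}(f_v)`) and ★
`IsArchEndoCharId` quantifies over EVERY matched test pair, so the two-term sign combination of (E1) below is the transfer of a VIRTUAL character, not of a genuine
unitary `ρ_∞`.  The definition is kept (a parametrised `Prop` asserts nothing; nothing imports it as a hypothesis; no Lines edition registers it); consumers use
`ArchBlockPacketEndoscopyLetter`.  Statement bytes below are UNCHANGED.

Cell `pub/hodgecm-mathlib`, Track B ∕ R90-TF, section S2, crux h413 = `stmt-HodgeConjecture-24833`, route `HCCMUnconditional`.  Typed by K2E4-p23 (g4) on S2 desk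
K2E1b-plan (g8)'s deal 2026-09-05T02:37:24Z (3) (re-dealt from LH7-p07 (g2)); §1 = the dealer's elaborated PROBE
`K2/K2E1b-plan/g8/PROBE-LETTERS-LT2E-Endoscopy.v1.K2E1b-plan-g8.lean` (sha16 c0b78bcc785a0bc2) §1 VERBATIM, its §0 stand-ins DELETED and replaced by the ★ imports
ℓ1 `R90S2ArchBlockPairLetterDefs` (`BlockPairData`, `memberSign`) and ℓ3 `R90S2TensorRepLetterDefs` (`HasLocalComponents`), plus the `_iff` read-back.

WHAT IS DEFINED (ONE closed-shape parametrised `Prop` + `Iff.rfl`; NO socket, NO instance, NO notation, NO `sorry`; nothing asserted).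
`ArchPacketEndoscopyLetter L μ S` — in T2's frame VERBATIM (`R90.S2.stub_R90_S2_archBlockPacketCusp`, D ED. 2 :90–:126: right-invariant Haar measures `ν, νH` on
`G_∞ = U(Φ₃)(L ⊗ ℝ)`, `H_∞`; Borel `letI`s on the orbit quotients; orbital-measure families `mH, mG` with centraliser Haar families `tH, t`; (W) `mG.IsQuotientOf (IsRegularElt ·) ν t`;
(C) the ★ `archStableCentralizerEquiv` transport of `t` along stable conjugacy; ★ `ArchCompatibleFamiliesH`; ★ `IsArchNondegenerate`; ★ `IsArchDeltaTransferExists` for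
smooth test functions), for EVERY family of local Haar measures `νw` matching `ν` along ★ `archPiEquivCM` (★ CARD 6 supplies one): THERE IS a choice of block-pair data
`d w : BlockPairData (U(σ_w Φ₃)(ℂ)) (νw w) (S w)` at every complex place `w` (print p. 218 L15–20: «ρ is chosen so that Π(ρ_v) is integrable … ⟨ρ_v, π_{1v}⟩ = 1,
⟨ρ_v, π_{2v}⟩ = −1», pseudo-coefficients `f_{1v}, f_{2v}`) such that
* (E1) every tensor family `ϖ k`, `k : places → Bool`, with local components `(d w).π (k w)` (★ ℓ3 `HasLocalComponents`) satisfies the archimedean endoscopic character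
  identity ★ `IsArchEndoCharId` with signs `s k = ∏_w memberSign (k w)` and SOME unitary `ρ_∞` of `H_∞` (Prop. 12.3.2 ⊗ places; the third member of the `L`-packet
  pairs to `0` with `ρ` and is absent);
* (E2) for every place `u`, the one-place difference tensor `⊗_{w ≠ u} φ⁺_w ⊗ (φ⁺_u − φ⁻_u)` is ★ `IsArchStablyNull` for `mG` (p. 218 L20–21; stable density + RIDER A′);
* (E3) for every place `u`, that tensor has an ★ `ArchSmooth₂` `Δ″_∞`-transfer `fH` (★ `IsArchDeltaTransfer`) that is ★ `CuspH₀` at every `ι` (p. 218 L22–25: «f^H can be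
  taken to be a linear combination of pseudo-coefficients on H»).
A LETTER: the hypothesis shape the assembly CARD 8 `archBlockPacketCusp_of_letters` consumes BY NAME; its payment is CLOSURE-row representation theory of `U(2,1)`,
`U(1,1) × U(1)` (Shelstad's archimedean transfer, Clozel–Delorme, Johnson ∕ Adams–Johnson) — not attempted in S2 this rung.

HONEST LABEL: a parametrised `Prop` asserts nothing and pays nothing; HC_CM is proved only modulo the 7 printed citations (2 remaining named inputs: hLiu418 =
stmt-HodgeConjecture-24832, h413 = stmt-HodgeConjecture-24833) until rung 0 closes.  Count-neutral (`--supports stmt-HodgeConjecture-24833`).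

References (print): Rogawski 1990 §13.8 p. 218 L15–25, §12.3 Prop. 12.3.2 ∕ 12.3.3 p. 178; Shelstad 1979 Lemma 5.3; Arthur 1988 (Invariant trace formula II) §7
p. 538; Clozel–Delorme 1984 Thm. 1.
-/

set_option autoImplicit false
set_option linter.dupNamespace false

noncomputable section

open NumberField NumberField.InfinitePlace MeasureTheory CompactlySupported
open scoped Matrix MatrixGroups InnerProductSpace

namespace Summit.HodgeConjecture.HodgeConjecture.R90.S2

open Literature.NumberTheory.Automorphic Literature.NumberTheory.Automorphic.UnitaryGroup
open Literature.NumberTheory.Rogawski1990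
open Literature.NumberTheory.GaloisRepresentations (HeckeCharacter)
open Summit.HodgeConjecture.HodgeConjecture.Cruxes.H413.K2E1bGKCohomologyU21.U8 (HasArchOpTrace)
open Summit.HodgeConjecture.HodgeConjecture.R90.S10 (GInf HInf phi3 archDeltaPP IsArchEndoCharId IsArchStablyNull)

/-! ## §1 «ℓT2-E» — the global-archimedean ENDOSCOPY LETTER for tensor families of block pairs -/

section Letter

variable (L : Type) [Field L] [NumberField L] [IsCMField L]

open scoped Classical in
/-- (SUPERSEDED two-member form — see the module ERRATUM; use ★ `ArchBlockPacketEndoscopyLetter`.)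
**«ℓT2-E» — the global-archimedean ENDOSCOPY LETTER** for tensor families of block pairs, in T2's frame VERBATIM (measures `ν, νH`, families `mH, mG, tH, t`,
(W), (C), ★ `ArchCompatibleFamiliesH`, non-degeneracy, transfer existence): for every family of local Haar measures `νw` matching `ν` along ★ `archPiEquivCM`
there is block-pair data `d w` (★ ℓ1 `BlockPairData`) at every complex place with (E1) the endoscopic character identity ★ `IsArchEndoCharId` for EVERY tensor
family of members (signs `∏_w memberSign (k w)`, some unitary `ρ_∞` of `H_∞`), (E2) stable nullity ★ `IsArchStablyNull` of every one-place difference tensor, and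
(E3) an ★ `ArchSmooth₂` `Δ″_∞`-transfer of it that is ★ `CuspH₀` at every `ι`.  A closed-shape parametrised `Prop` (binders `μ`, `S`): nothing is asserted;
the assembly consumes it by name; its payment is CLOSURE-row archimedean representation theory (print: Rogawski 1990 §13.8 p. 218 L15–25 and Prop. 12.3.2 ∕
12.3.3 p. 178; Shelstad 1979 Lemma 5.3; Arthur 1988 §7 p. 538; Clozel–Delorme 1984) — the citation tokens ride on `archPacketEndoscopyLetter_iff`. -/
def ArchPacketEndoscopyLetter (μ : HeckeCharacter L)
    (S : ∀ w : {w : InfinitePlace L // w.IsComplex}, C_c(↥(archLocal L 3 (phi3 L) w), ℂ) → Prop) : Prop :=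
  ∀ [MeasurableSpace (GInf L)] [BorelSpace (GInf L)] (ν : Measure (GInf L)) [ν.IsHaarMeasure] [ν.IsMulRightInvariant]
    [MeasurableSpace (HInf L)] [BorelSpace (HInf L)] (νH : Measure (HInf L)) [νH.IsHaarMeasure] [νH.IsMulRightInvariant],
  letI : ∀ a : HInf L, MeasurableSpace (HInf L ⧸ Subgroup.centralizer ({a} : Set (HInf L))) := fun _ => borel _
  haveI : ∀ a : HInf L, BorelSpace (HInf L ⧸ Subgroup.centralizer ({a} : Set (HInf L))) := fun _ => ⟨rfl⟩
  letI : ∀ γ : GInf L, MeasurableSpace (GInf L ⧸ Subgroup.centralizer ({γ} : Set (GInf L))) := fun _ => borel _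
  haveI : ∀ γ : GInf L, BorelSpace (GInf L ⧸ Subgroup.centralizer ({γ} : Set (GInf L))) := fun _ => ⟨rfl⟩
  ∀ (mH : OrbitalMeasureFamily (HInf L)) (mG : OrbitalMeasureFamily (GInf L))
    (tH : ∀ a : HInf L, Measure (Subgroup.centralizer ({a} : Set (HInf L))))
    (t : ∀ γ : GInf L, Measure (Subgroup.centralizer ({γ} : Set (GInf L)))),
    mG.IsQuotientOf (fun γ => IsRegularElt (γ.val : GL (Fin 3) (mixedEmbedding.mixedSpace L))) ν t →
    (∀ (γ₁ γ₂ : GInf L)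
        (h₁ : IsRegularElt (γ₁.val : GL (Fin 3) (mixedEmbedding.mixedSpace L)))
        (hc : Corresponds (UnitaryGroup.conjMixed (↥(maximalRealSubfield L)) L (IsCMField.complexConj L))
          (UnitaryGroup.archFormOf L 3 (phi3 L)) (UnitaryGroup.archFormOf L 3 (phi3 L)) γ₁ γ₂),
        Measure.map ⇑(UnitaryGroup.archStableCentralizerEquiv L (UnitaryGroup.isUnit_antidiagOne_det L 3).ne_zero
          (UnitaryGroup.isUnit_antidiagOne_det L 3).ne_zero hc h₁) (t γ₁) = t γ₂) →
    ArchCompatibleFamiliesH L νH mH tH t →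
    IsArchNondegenerate L (phi3 L) (archDeltaPP L μ) →
    IsArchDeltaTransferExists L (phi3 L) (archDeltaPP L μ) mH mG (ArchSmooth L 3 (phi3 L)) (ArchSmooth₂ L) →
    ∀ [∀ w : {w : InfinitePlace L // w.IsComplex}, MeasurableSpace ↥(archLocal L 3 (phi3 L) w)]
      [∀ w : {w : InfinitePlace L // w.IsComplex}, BorelSpace ↥(archLocal L 3 (phi3 L) w)]
      (νw : ∀ w : {w : InfinitePlace L // w.IsComplex}, Measure ↥(archLocal L 3 (phi3 L) w))
      [∀ w, (νw w).IsHaarMeasure],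
      ν.map ⇑(archPiEquivCM L (phi3 L) (N := 3)) = Measure.pi νw →
      ∃ d : ∀ w : {w : InfinitePlace L // w.IsComplex}, BlockPairData ↥(archLocal L 3 (phi3 L) w) (νw w) (S w),
        -- (E1) endoscopic character identity for every tensor family of members
        (∀ (EG : ({w : InfinitePlace L // w.IsComplex} → Bool) → Type)
            [∀ k, NormedAddCommGroup (EG k)] [∀ k, InnerProductSpace ℂ (EG k)] [∀ k, CompleteSpace (EG k)]
            (ϖ : ∀ k, ContRepresentation ℂ (GInf L) (EG k)) (hu : ∀ k, (ϖ k).IsUnitary) (hsc : ∀ k, (ϖ k).IsStronglyContinuous),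
            (∀ k, letI := fun w => (d w).instNACG (k w); letI := fun w => (d w).instIPS (k w); letI := fun w => (d w).instCS (k w)
              HasLocalComponents (archPiEquivCM L (phi3 L) (N := 3)) ν νw (ϖ k) (hu k) (hsc k)
                (fun w => (d w).E (k w)) (fun w => (d w).π (k w)) (fun w => (d w).hu (k w)) (fun w => (d w).hsc (k w))) →
            ∃ (EH : Type) (_ : NormedAddCommGroup EH) (_ : InnerProductSpace ℂ EH) (_ : CompleteSpace EH)
              (ρ : ContRepresentation ℂ (HInf L) EH) (huH : ρ.IsUnitary) (hscH : ρ.IsStronglyContinuous),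
              IsArchEndoCharId L (archDeltaPP L μ) mH mG ν νH EG ϖ hu hsc (fun k => ∏ w, memberSign (k w)) ρ huH hscH) ∧
        -- (E2) + (E3) per place `u`: the one-place difference tensor is stably null and has a cuspidal smooth transfer
        (∀ u : {w : InfinitePlace L // w.IsComplex},
          IsArchStablyNull L mG
              ⇑(archTensor L (phi3 L) (Function.update (fun w => (d w).φ true) u ((d u).φ true - (d u).φ false))) ∧
            ∃ fH : C_c(HInf L, ℂ), ArchSmooth₂ L ⇑fH ∧
              IsArchDeltaTransfer L (phi3 L) (archDeltaPP L μ) mH mG ⇑fH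
                ⇑(archTensor L (phi3 L) (Function.update (fun w => (d w).φ true) u ((d u).φ true - (d u).φ false))) ∧
              ∀ ι : L →+* ℂ, CuspH₀ L mH ι ⇑fH)

open scoped Classical in
/-- Unfolding of `ArchPacketEndoscopyLetter` (definitional): the global-archimedean endoscopy letter for tensor families of block pairs, in T2's frame — (E1) the
endoscopic character identity of Prop. 12.3.2 tensored over the complex places with the signs `⟨ρ_v, π_{1v}⟩ = 1`, `⟨ρ_v, π_{2v}⟩ = −1` of the chosen integrable
`ρ`, (E2) stable nullity of the one-place pseudo-coefficient differences, (E3) their smooth cuspidal `Δ″_∞`-transfers («`f^H` a linear combination of pseudo-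
coefficients on `H`»). [cite: Rogawski1990, §13.8 p. 218 L15–25; §12.3 Prop. 12.3.2 p. 178] [cite: Shelstad1979, L. 5.3] [cite: Arthur1988InvariantTraceFormulaII, §7 p. 538]
[cite: ClozelDelorme1984] -/
theorem archPacketEndoscopyLetter_iff (μ : HeckeCharacter L)
    (S : ∀ w : {w : InfinitePlace L // w.IsComplex}, C_c(↥(archLocal L 3 (phi3 L) w), ℂ) → Prop) :
    ArchPacketEndoscopyLetter L μ S ↔
      ∀ [MeasurableSpace (GInf L)] [BorelSpace (GInf L)] (ν : Measure (GInf L)) [ν.IsHaarMeasure] [ν.IsMulRightInvariant]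
        [MeasurableSpace (HInf L)] [BorelSpace (HInf L)] (νH : Measure (HInf L)) [νH.IsHaarMeasure] [νH.IsMulRightInvariant],
      letI : ∀ a : HInf L, MeasurableSpace (HInf L ⧸ Subgroup.centralizer ({a} : Set (HInf L))) := fun _ => borel _
      haveI : ∀ a : HInf L, BorelSpace (HInf L ⧸ Subgroup.centralizer ({a} : Set (HInf L))) := fun _ => ⟨rfl⟩
      letI : ∀ γ : GInf L, MeasurableSpace (GInf L ⧸ Subgroup.centralizer ({γ} : Set (GInf L))) := fun _ => borel _
      haveI : ∀ γ : GInf L, BorelSpace (GInf L ⧸ Subgroup.centralizer ({γ} : Set (GInf L))) := fun _ => ⟨rfl⟩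
      ∀ (mH : OrbitalMeasureFamily (HInf L)) (mG : OrbitalMeasureFamily (GInf L))
        (tH : ∀ a : HInf L, Measure (Subgroup.centralizer ({a} : Set (HInf L))))
        (t : ∀ γ : GInf L, Measure (Subgroup.centralizer ({γ} : Set (GInf L)))),
        mG.IsQuotientOf (fun γ => IsRegularElt (γ.val : GL (Fin 3) (mixedEmbedding.mixedSpace L))) ν t →
        (∀ (γ₁ γ₂ : GInf L)
            (h₁ : IsRegularElt (γ₁.val : GL (Fin 3) (mixedEmbedding.mixedSpace L)))
            (hc : Corresponds (UnitaryGroup.conjMixed (↥(maximalRealSubfield L)) L (IsCMField.complexConj L))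
              (UnitaryGroup.archFormOf L 3 (phi3 L)) (UnitaryGroup.archFormOf L 3 (phi3 L)) γ₁ γ₂),
            Measure.map ⇑(UnitaryGroup.archStableCentralizerEquiv L (UnitaryGroup.isUnit_antidiagOne_det L 3).ne_zero
              (UnitaryGroup.isUnit_antidiagOne_det L 3).ne_zero hc h₁) (t γ₁) = t γ₂) →
        ArchCompatibleFamiliesH L νH mH tH t →
        IsArchNondegenerate L (phi3 L) (archDeltaPP L μ) →
        IsArchDeltaTransferExists L (phi3 L) (archDeltaPP L μ) mH mG (ArchSmooth L 3 (phi3 L)) (ArchSmooth₂ L) →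
        ∀ [∀ w : {w : InfinitePlace L // w.IsComplex}, MeasurableSpace ↥(archLocal L 3 (phi3 L) w)]
          [∀ w : {w : InfinitePlace L // w.IsComplex}, BorelSpace ↥(archLocal L 3 (phi3 L) w)]
          (νw : ∀ w : {w : InfinitePlace L // w.IsComplex}, Measure ↥(archLocal L 3 (phi3 L) w))
          [∀ w, (νw w).IsHaarMeasure],
          ν.map ⇑(archPiEquivCM L (phi3 L) (N := 3)) = Measure.pi νw →
          ∃ d : ∀ w : {w : InfinitePlace L // w.IsComplex}, BlockPairData ↥(archLocal L 3 (phi3 L) w) (νw w) (S w),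
            (∀ (EG : ({w : InfinitePlace L // w.IsComplex} → Bool) → Type)
                [∀ k, NormedAddCommGroup (EG k)] [∀ k, InnerProductSpace ℂ (EG k)] [∀ k, CompleteSpace (EG k)]
                (ϖ : ∀ k, ContRepresentation ℂ (GInf L) (EG k)) (hu : ∀ k, (ϖ k).IsUnitary) (hsc : ∀ k, (ϖ k).IsStronglyContinuous),
                (∀ k, letI := fun w => (d w).instNACG (k w); letI := fun w => (d w).instIPS (k w); letI := fun w => (d w).instCS (k w)
                  HasLocalComponents (archPiEquivCM L (phi3 L) (N := 3)) ν νw (ϖ k) (hu k) (hsc k)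
                    (fun w => (d w).E (k w)) (fun w => (d w).π (k w)) (fun w => (d w).hu (k w)) (fun w => (d w).hsc (k w))) →
                ∃ (EH : Type) (_ : NormedAddCommGroup EH) (_ : InnerProductSpace ℂ EH) (_ : CompleteSpace EH)
                  (ρ : ContRepresentation ℂ (HInf L) EH) (huH : ρ.IsUnitary) (hscH : ρ.IsStronglyContinuous),
                  IsArchEndoCharId L (archDeltaPP L μ) mH mG ν νH EG ϖ hu hsc (fun k => ∏ w, memberSign (k w)) ρ huH hscH) ∧
            (∀ u : {w : InfinitePlace L // w.IsComplex},
              IsArchStablyNull L mG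
                  ⇑(archTensor L (phi3 L) (Function.update (fun w => (d w).φ true) u ((d u).φ true - (d u).φ false))) ∧
                ∃ fH : C_c(HInf L, ℂ), ArchSmooth₂ L ⇑fH ∧
                  IsArchDeltaTransfer L (phi3 L) (archDeltaPP L μ) mH mG ⇑fH
                    ⇑(archTensor L (phi3 L) (Function.update (fun w => (d w).φ true) u ((d u).φ true - (d u).φ false))) ∧
                  ∀ ι : L →+* ℂ, CuspH₀ L mH ι ⇑fH) :=
  Iff.rfl

end Letter

end Summit.HodgeConjecture.HodgeConjecture.R90.S2

end
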